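import Summits.AtomisticToContinuum.Crystallization.Theorems.PalmUnimodularRigidityMinimiserShellsResidual
import Summits.AtomisticToContinuum.Crystallization.Theorems.PalmUnimodularRigidityMinimiserShellsEquilibriumInLawShells
import Literature.MathematicalPhysics.StatisticalMechanics.LennardJonesClusters

/-!
# Periodic assembly of the local elastic gap (stub `stub_periodicAssembly`, line `elastic-coarse-to-fine`)

Stub `stub_periodicAssembly` of line `elastic-coarse-to-fine` of crux `MinimiserShells`
(stmt-AtomisticToContinuum-9225, route `PalmUnimodularRigidity`): pure bookkeeping, an implication.  ASSUME the
local elastic coarse-to-fine inequality `H` (some `c > 0`; for every slack `ε > 0` a radius `R > 0` and a charge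
`C ≥ 0`; for every finite injective `1/3`-separated `y : Fin N → ℝ³` and every set `Ω` of sites whose re-rooted
shells pass `LooseGoodShell (1/20)`: `c·#{i ∈ Ω finely bad} − C·#{i ∈ Ω with a site outside Ω within R} − ε·#Ω ≤
Σ_{i∈Ω} (𝓔ⁱ(y)/2 − e*)`).  THEN for every `t > 0` there are `s, κ > 0` such that every periodic `Q` with
`1/3`-separated points, at least `t·#motif` FINELY badly shelled (`looseBadMotifCount 0`) and fewer than `s·#motif`
COARSELY badly shelled (`looseBadMotifCount (1/20)`) motif sites has `e(Q) ≥ e* + κ`.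

* `exists_blocks₂` — blocks with TWO local predicates (after `NecessityBlocks.exists_blocks`): the `K³`-block
  of `Q` (`K` large) is injective, `1/3`-separated, has energy `≤ N·(e(Q) + ε')`, at least `(t − ε')·N` finely
  bad indices (`NecessityBlocks.card_bad_block_ge`) and at most `(s + ε')·N` coarsely bad indices (the new
  count `card_bad_block_le`: deep block indices get the verdict of their motif site, `NecessityBlocks.block_iff`).
* `le_interactionEnergy_of_local` — the assembly for one finite configuration and abstract site predicates `Pc`
  (coarsely good), `Pf` (finely good): with `Bad = {¬ Pc}` and `Ω = {i | Pc i ∧ every j ∈ Bad is R-far from i}`,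
  `Ωᶜ` lies within `R` and the `R`-boundary of `Ω` within `2R` of `Bad` (both `≤ #Bad·(6ρ+1)³` by packing),
  site energies are `≥ −30375`, and `Σ_i 𝓔ⁱ = 2·𝓔_N`; hence
  `𝓔_N(y) ≥ e*·N + c·#{¬ Pf} − M·#{¬ Pc} − ε·N`, `M = (|e*| + c + 30375/2)·(6R+1)³ + C·(12R+1)³`.
* `stub_periodicAssembly` — `ε = c·t/8`, `s = (c·t/8)/(c + 1 + 2M)`, `ε' = s`, `κ = c·t/2`; divide by `N`.
-/

noncomputable section

open MeasureTheory
open scoped ENNReal BigOperators Classical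

namespace Summit.AtomisticToContinuum.Crystallization.Theorems.PalmUnimodularRigidityMinimiserShells.PeriodicAssembly

open Literature.MathematicalPhysics.StatisticalMechanics (lennardJones siteEnergy interactionEnergy PeriodicConfiguration
  card_le_of_separated_of_dist_le sum_inv_pow_six_le two_mul_interactionEnergy)
open Summit.AtomisticToContinuum.Crystallization.Theorems.MinimiserShells.Negative.LoadBearing (eStar GoodShell)
open Summit.AtomisticToContinuum.Crystallization.Theorems.MinimiserShells.Negative.Rootedness (E3)
open Summit.AtomisticToContinuum.Crystallization.Theorems.PalmUnimodularRigidityMinimiserShells.Residual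
  (ShellGap IsSepThird looseBadMotifCount LooseGoodShell rerooted looseGoodShell_zero_iff looseBadMotifCount_zero)
open Summit.AtomisticToContinuum.Crystallization.Theorems.ChargedEnergyGapNegative.Blocks
  (BIdx bpt card_BIdx blockConfig blockConfig_apply blockConfig_injective IsDeep depth
   exists_block_energy_le card_deep_ge card_not_deep_le)
open Summit.AtomisticToContinuum.Crystallization.Theorems.PalmUnimodularRigidity.LayeredLawsSelectHcp
  (range_blockConfig_subset)
open Summit.AtomisticToContinuum.Crystallization.Theorems.PalmUnimodularRigidityMinimiserShells.NecessityBlocks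
  (block_iff card_bad_block_ge looseGood_congr_of_local)
open Summit.AtomisticToContinuum.Crystallization.Theorems.PalmUnimodularRigidityMinimiserShells.ShellNoBoundary
  (goodShell_congr_of_local)

/-! ## Blocks with two local predicates -/

/-- **Few bad block indices from few bad motif sites** (for a LOCAL predicate `G`: two measures with the same
atoms in `B̄(0, 5/4)` get the same verdict).  A block index with `depth Q 2`-deep lattice coordinates gets the
verdict of its motif site (`NecessityBlocks.block_iff`), so
`#{a // ¬ G at a in the block} ≤ #F · 6·depth·K² + #{x ∈ F // ¬ G at x in Q.points} · K³`
(`Blocks.card_not_deep_le`). -/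
theorem card_bad_block_le {G : Measure E3 → Prop}
    (hloc : ∀ {μ ν : Measure E3}, (∀ w : E3, ‖w‖ ≤ 5 / 4 → (μ {w} ≠ 0 ↔ ν {w} ≠ 0)) → (G μ ↔ G ν))
    (Q : PeriodicConfiguration 3) (K : ℕ) :
    Nat.card {a : Fin (Fintype.card (BIdx Q K)) // ¬ G ((Measure.count : Measure E3).restrict
        ((fun z => z - blockConfig Q K a) '' Set.range (blockConfig Q K)))} ≤
      Q.motif.card * (6 * depth Q 2 * K ^ 2) +
        Nat.card {x : Q.motif // ¬ G ((Measure.count : Measure E3).restrict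
          ((fun z => z - (x : E3)) '' Q.points))} * K ^ 3 := by
  classical
  have h1 : Nat.card {a : Fin (Fintype.card (BIdx Q K)) // ¬ G ((Measure.count : Measure E3).restrict
        ((fun z => z - blockConfig Q K a) '' Set.range (blockConfig Q K)))} =
      Nat.card {u : BIdx Q K // ¬ G ((Measure.count : Measure E3).restrict
        ((fun z => z - bpt Q K u) '' Set.range (blockConfig Q K)))} :=
    Nat.card_congr ((Fintype.equivFin (BIdx Q K)).symm.subtypeEquiv fun _ => Iff.rfl)
  rw [h1, Nat.card_eq_fintype_card, Fintype.card_subtype, Nat.card_eq_fintype_card, Fintype.card_subtype]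
  have hsub : (Finset.univ.filter fun u : BIdx Q K => ¬ G ((Measure.count : Measure E3).restrict
        ((fun z => z - bpt Q K u) '' Set.range (blockConfig Q K)))) ⊆
      (Finset.univ.filter fun u : BIdx Q K => ¬ IsDeep K (depth Q 2) u.2) ∪
        (Finset.univ.filter fun u : BIdx Q K => ¬ G ((Measure.count : Measure E3).restrict
          ((fun z => z - ((u.1 : Q.motif) : E3)) '' Q.points))) := by
    rintro ⟨x, k⟩ hu
    rw [Finset.mem_union, Finset.mem_filter, Finset.mem_filter]
    by_cases hk : IsDeep K (depth Q 2) k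
    · exact Or.inr ⟨Finset.mem_univ _, fun hG => (Finset.mem_filter.1 hu).2 ((block_iff hloc Q K x hk).2 hG)⟩
    · exact Or.inl ⟨Finset.mem_univ _, hk⟩
  refine (Finset.card_le_card hsub).trans ((Finset.card_union_le _ _).trans (add_le_add ?_ (le_of_eq ?_)))
  · rw [← Finset.univ_product_univ, Finset.filter_product_right (q := fun k => ¬ IsDeep K (depth Q 2) k),
      Finset.card_product, Finset.card_univ, Fintype.card_coe]
    exact Nat.mul_le_mul_left _ (card_not_deep_le K (depth Q 2))
  · rw [← Finset.univ_product_univ, Finset.filter_product_left (p := fun x : Q.motif =>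
        ¬ G ((Measure.count : Measure E3).restrict ((fun z => z - (x : E3)) '' Q.points))),
      Finset.card_product, Finset.card_univ, Fintype.card_fun, Fintype.card_fin, Fintype.card_fin]

/-- **Blocks of a hard-core periodic configuration with TWO local predicates** `G₁`, `G₂`: if `Q` (periodic,
`1/3`-separated points) has at least `t · #F` motif sites with `¬ G₁` and at most `s · #F` with `¬ G₂` (at the
re-rooted point sets `count|((· - x) '' Q.points)`), then for every `ε > 0` some block `blockConfig Q K` is a finite
injective `1/3`-separated `y : Fin N → ℝ³`, `N > 0`, with `𝓔_N(y) ≤ N · (e(Q) + ε)` (`Blocks.exists_block_energy_le`),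
at least `(t − ε) · N` indices with `¬ G₁` (`NecessityBlocks.card_bad_block_ge`) and at most `(s + ε) · N` indices
with `¬ G₂` (`card_bad_block_le`) at `count|((· - y i) '' range y)`. -/
theorem exists_blocks₂ {G₁ G₂ : Measure E3 → Prop}
    (hloc₁ : ∀ {μ ν : Measure E3}, (∀ w : E3, ‖w‖ ≤ 5 / 4 → (μ {w} ≠ 0 ↔ ν {w} ≠ 0)) → (G₁ μ ↔ G₁ ν))
    (hloc₂ : ∀ {μ ν : Measure E3}, (∀ w : E3, ‖w‖ ≤ 5 / 4 → (μ {w} ≠ 0 ↔ ν {w} ≠ 0)) → (G₂ μ ↔ G₂ ν))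
    (Q : PeriodicConfiguration 3)
    (hsep : ∀ p ∈ Q.points, ∀ q ∈ Q.points, p ≠ q → (1 : ℝ) / 3 ≤ dist p q) (t s : ℝ)
    (hbad : t * (Q.motif.card : ℝ) ≤ (Nat.card {x : Q.motif //
      ¬ G₁ ((Measure.count : Measure E3).restrict ((fun z => z - (x : E3)) '' Q.points))} : ℝ))
    (hfew : (Nat.card {x : Q.motif //
      ¬ G₂ ((Measure.count : Measure E3).restrict ((fun z => z - (x : E3)) '' Q.points))} : ℝ) ≤
      s * (Q.motif.card : ℝ))
    {ε : ℝ} (hε : 0 < ε) :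
    ∃ N : ℕ, 0 < N ∧ ∃ y : Fin N → E3, Function.Injective y ∧
      (∀ i j : Fin N, i ≠ j → (1 : ℝ) / 3 ≤ dist (y i) (y j)) ∧
      interactionEnergy lennardJones y ≤ (N : ℝ) * (Q.energyPerParticle lennardJones + ε) ∧
      (t - ε) * (N : ℝ) ≤ (Nat.card {i : Fin N //
        ¬ G₁ ((Measure.count : Measure E3).restrict ((fun z => z - y i) '' Set.range y))} : ℝ) ∧
      (Nat.card {i : Fin N //
        ¬ G₂ ((Measure.count : Measure E3).restrict ((fun z => z - y i) '' Set.range y))} : ℝ) ≤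
        (s + ε) * (N : ℝ) := by
  have hF : (0 : ℝ) < Q.motif.card := by exact_mod_cast Q.motif_nonempty.card_pos
  -- blocks are trial states with slack `ε` per particle
  obtain ⟨K₀, hK₀, hK⟩ := exists_block_energy_le Q hε
  -- a large `K`: beyond `K₀`, with `6 · depth · t ≤ ε · K` and `6 · depth ≤ ε · K`
  obtain ⟨K, hKK₀, hKt, hKs⟩ : ∃ K : ℕ, K₀ ≤ K ∧ 6 * (depth Q 2 : ℝ) * t / ε ≤ K ∧
      6 * (depth Q 2 : ℝ) / ε ≤ K :=
    ⟨max K₀ (max ⌈6 * (depth Q 2 : ℝ) * t / ε⌉₊ ⌈6 * (depth Q 2 : ℝ) / ε⌉₊), le_max_left _ _,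
      (Nat.le_ceil _).trans (by exact_mod_cast (le_max_left _ _).trans (le_max_right _ _)),
      (Nat.le_ceil _).trans (by exact_mod_cast (le_max_right _ _).trans (le_max_right _ _))⟩
  have hKpos : 0 < K := lt_of_lt_of_le hK₀ hKK₀
  have hKr : (0 : ℝ) < K := by exact_mod_cast hKpos
  have hn : ((Fintype.card (BIdx Q K) : ℕ) : ℝ) = Q.motif.card * (K : ℝ) ^ 3 := by
    exact_mod_cast card_BIdx Q K
  have hN : 0 < Fintype.card (BIdx Q K) := by
    rw [card_BIdx]; exact mul_pos Q.motif_nonempty.card_pos (pow_pos hKpos 3)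
  have hFK : (0 : ℝ) < Q.motif.card * (K : ℝ) ^ 3 := mul_pos hF (pow_pos hKr 3)
  have hFK2 : (0 : ℝ) ≤ Q.motif.card * (K : ℝ) ^ 2 := by positivity
  refine ⟨Fintype.card (BIdx Q K), hN, blockConfig Q K, blockConfig_injective Q K, fun i j hij => ?_,
    hK K hKK₀, ?_, ?_⟩
  · -- the separation is inherited from `Q.points`
    exact hsep _ (range_blockConfig_subset Q K ⟨i, rfl⟩) _ (range_blockConfig_subset Q K ⟨j, rfl⟩)
      fun h => hij (blockConfig_injective Q K h)
  · -- many bad block indices for `G₁`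
    rw [hn]
    set B := Nat.card {a : Fin (Fintype.card (BIdx Q K)) // ¬ G₁ ((Measure.count : Measure E3).restrict
      ((fun z => z - blockConfig Q K a) '' Set.range (blockConfig Q K)))}
    have hB0 : (0 : ℝ) ≤ B := Nat.cast_nonneg _
    by_cases ht : t ≤ ε
    · -- a nonpositive threshold is trivially met
      exact le_trans (mul_nonpos_of_nonpos_of_nonneg (by linarith) hFK.le) hB0
    · push Not at ht
      have ht0 : 0 < t := hε.trans ht
      set d := depth Q 2
      set D := Nat.card {k : Fin 3 → Fin K // IsDeep K d k}
      set M := Nat.card {x : Q.motif //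
        ¬ G₁ ((Measure.count : Measure E3).restrict ((fun z => z - (x : E3)) '' Q.points))}
      have h1 : (K : ℝ) ^ 3 - 6 * (d : ℝ) * (K : ℝ) ^ 2 ≤ (D : ℝ) := by
        have := (Nat.cast_le (α := ℝ)).2 (card_deep_ge K d)
        push_cast at this
        linarith
      have h2 : (D : ℝ) * (M : ℝ) ≤ (B : ℝ) := by exact_mod_cast card_bad_block_ge hloc₁ Q K
      have h6 : 6 * (d : ℝ) * t ≤ ε * K := by rw [div_le_iff₀ hε] at hKt; linarith
      linarith [mul_le_mul_of_nonneg_right h6 hFK2, mul_le_mul_of_nonneg_right h1 (mul_nonneg ht0.le hF.le),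
        mul_le_mul_of_nonneg_left hbad (Nat.cast_nonneg D : (0 : ℝ) ≤ D)]
  · -- few bad block indices for `G₂`
    rw [hn]
    have hcnt := card_bad_block_le hloc₂ Q K
    set d := depth Q 2
    set B := Nat.card {a : Fin (Fintype.card (BIdx Q K)) // ¬ G₂ ((Measure.count : Measure E3).restrict
      ((fun z => z - blockConfig Q K a) '' Set.range (blockConfig Q K)))}
    set M := Nat.card {x : Q.motif //
      ¬ G₂ ((Measure.count : Measure E3).restrict ((fun z => z - (x : E3)) '' Q.points))}
    have h1 : (B : ℝ) ≤ Q.motif.card * (6 * (d : ℝ) * (K : ℝ) ^ 2) + (M : ℝ) * (K : ℝ) ^ 3 := by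
      exact_mod_cast hcnt
    have h6 : 6 * (d : ℝ) ≤ ε * K := by rw [div_le_iff₀ hε] at hKs; linarith
    have h2 : (Q.motif.card : ℝ) * (6 * (d : ℝ) * (K : ℝ) ^ 2) ≤ Q.motif.card * (ε * K * (K : ℝ) ^ 2) :=
      mul_le_mul_of_nonneg_left (mul_le_mul_of_nonneg_right h6 (by positivity)) hF.le
    have h3 : (M : ℝ) * (K : ℝ) ^ 3 ≤ s * Q.motif.card * (K : ℝ) ^ 3 :=
      mul_le_mul_of_nonneg_right hfew (by positivity)
    calc (B : ℝ) ≤ Q.motif.card * (6 * (d : ℝ) * (K : ℝ) ^ 2) + (M : ℝ) * (K : ℝ) ^ 3 := h1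
      _ ≤ Q.motif.card * (ε * K * (K : ℝ) ^ 2) + s * Q.motif.card * (K : ℝ) ^ 3 := add_le_add h2 h3
      _ = (s + ε) * (Q.motif.card * (K : ℝ) ^ 3) := by ring

/-! ## Packing and the energy floor for finite `1/3`-separated configurations -/

/-- **Site energies of `1/3`-separated configurations are `≥ −30375 = −(250/6)·3⁶`** (drop the repulsion,
`EnergyFloor.neg_lennardJones_le`, and the shell sum `sum_inv_pow_six_le`). -/
theorem neg_le_siteEnergy {N : ℕ} (y : Fin N → E3)
    (hsep : ∀ i j : Fin N, i ≠ j → (1 : ℝ) / 3 ≤ dist (y i) (y j)) (i : Fin N) :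
    -(30375 : ℝ) ≤ siteEnergy lennardJones y i := by
  have hS := sum_inv_pow_six_le y (by norm_num : (0 : ℝ) < 1 / 3) hsep i
  have h3 : ((1 : ℝ) / 3)⁻¹ ^ 6 = 729 := by norm_num
  rw [h3] at hS
  unfold siteEnergy
  calc -(30375 : ℝ) ≤ ∑ k ∈ Finset.univ.erase i, -(1 / 6 * (dist (y i) (y k))⁻¹ ^ 6) := by
        rw [Finset.sum_neg_distrib, ← Finset.mul_sum]
        linarith
    _ ≤ ∑ k ∈ Finset.univ.erase i, lennardJones (dist (y i) (y k)) :=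
        Finset.sum_le_sum fun k _ => by linarith [EnergyFloor.neg_lennardJones_le (dist (y i) (y k))]

/-- **Packing**: in an injective `1/3`-separated configuration at most `(6ρ+1)³` indices lie within distance
`ρ` of a given point (`card_le_of_separated_of_dist_le` in `ℝ³`). -/
theorem card_filter_dist_le {N : ℕ} (y : Fin N → E3) (hy : Function.Injective y)
    (hsep : ∀ i j : Fin N, i ≠ j → (1 : ℝ) / 3 ≤ dist (y i) (y j)) (p : E3) {ρ : ℝ} (hρ : 0 ≤ ρ) :
    ((Finset.univ.filter fun i : Fin N => dist (y i) p ≤ ρ).card : ℝ) ≤ (6 * ρ + 1) ^ 3 := by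
  have h := card_le_of_separated_of_dist_le
    ((Finset.univ.filter fun i : Fin N => dist (y i) p ≤ ρ).image y) p
    (by norm_num : (0 : ℝ) < 1 / 3) hρ
    (fun c hc => by
      obtain ⟨i, hi, rfl⟩ := Finset.mem_image.1 hc
      exact (Finset.mem_filter.1 hi).2)
    (fun c hc d hd hcd => by
      obtain ⟨i, _, rfl⟩ := Finset.mem_image.1 hc
      obtain ⟨j, _, rfl⟩ := Finset.mem_image.1 hd
      exact hsep i j fun h => hcd (congrArg y h))
  rwa [Finset.card_image_of_injective _ hy, finrank_euclideanSpace_fin,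
    show 2 * ρ / (1 / 3) + 1 = 6 * ρ + 1 by ring] at h

/-- At most `#S · (6ρ+1)³` indices lie within distance `ρ` of (the point of) some index of `S`
(`Finset.card_biUnion_le` and `card_filter_dist_le`). -/
theorem card_near_le {N : ℕ} (y : Fin N → E3) (hy : Function.Injective y)
    (hsep : ∀ i j : Fin N, i ≠ j → (1 : ℝ) / 3 ≤ dist (y i) (y j)) (S : Finset (Fin N)) {ρ : ℝ}
    (hρ : 0 ≤ ρ) :
    ((Finset.univ.filter fun i : Fin N => ∃ k ∈ S, dist (y i) (y k) ≤ ρ).card : ℝ) ≤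
      (S.card : ℝ) * (6 * ρ + 1) ^ 3 := by
  have hsub : (Finset.univ.filter fun i : Fin N => ∃ k ∈ S, dist (y i) (y k) ≤ ρ) ⊆
      S.biUnion fun k => Finset.univ.filter fun i : Fin N => dist (y i) (y k) ≤ ρ := by
    intro i hi
    obtain ⟨k, hk, hik⟩ := (Finset.mem_filter.1 hi).2
    exact Finset.mem_biUnion.2 ⟨k, hk, Finset.mem_filter.2 ⟨Finset.mem_univ _, hik⟩⟩
  calc ((Finset.univ.filter fun i : Fin N => ∃ k ∈ S, dist (y i) (y k) ≤ ρ).card : ℝ)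
      ≤ ∑ k ∈ S, ((Finset.univ.filter fun i : Fin N => dist (y i) (y k) ≤ ρ).card : ℝ) := by
        exact_mod_cast (Finset.card_le_card hsub).trans Finset.card_biUnion_le
    _ ≤ ∑ k ∈ S, (6 * ρ + 1) ^ 3 := Finset.sum_le_sum fun k _ => card_filter_dist_le y hy hsep (y k) hρ
    _ = (S.card : ℝ) * (6 * ρ + 1) ^ 3 := by rw [Finset.sum_const, nsmul_eq_mul]

/-! ## The assembly for one finite configuration -/

/-- **Local-to-global assembly for one finite configuration.**  Let `y : Fin N → ℝ³` be injective and
`1/3`-separated, `Pc` ("coarsely good"), `Pf` ("finely good") predicates on indices, and suppose for every `Ω` of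
coarsely good indices `c·#{i ∈ Ω, ¬ Pf i} − C·#{i ∈ Ω with some j ∉ Ω, dist ≤ R} − ε·#Ω ≤ Σ_{i∈Ω} (𝓔ⁱ(y)/2 − e₀)`.
Then `e₀·N + c·#{¬ Pf} − M·#{¬ Pc} − ε·N ≤ 𝓔_N(y)`, `M = (|e₀| + c + 30375/2)·(6R+1)³ + C·(12R+1)³`: apply the
inequality to the guarded region `Ω = {i | Pc i ∧ ∀ j, ¬ Pc j → R < dist (y i) (y j)}` (its complement lies within
`R`, its `R`-boundary within `2R` of a coarsely bad index: `card_near_le`), bound the site energies off `Ω` below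
by `−30375` (`neg_le_siteEnergy`), and use `Σ_i 𝓔ⁱ = 2·𝓔_N`. -/
theorem le_interactionEnergy_of_local {N : ℕ} (y : Fin N → E3) (hy : Function.Injective y)
    (hsep : ∀ i j : Fin N, i ≠ j → (1 : ℝ) / 3 ≤ dist (y i) (y j))
    (Pc Pf : Fin N → Prop) {c C R ε e₀ : ℝ} (hc : 0 ≤ c) (hC : 0 ≤ C) (hR : 0 ≤ R) (hε : 0 ≤ ε)
    (hΩ : ∀ Ω : Finset (Fin N), (∀ i ∈ Ω, Pc i) →
      c * (Nat.card {i : Fin N // i ∈ Ω ∧ ¬ Pf i} : ℝ)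
        - C * (Nat.card {i : Fin N // i ∈ Ω ∧ ∃ j : Fin N, j ∉ Ω ∧ dist (y i) (y j) ≤ R} : ℝ)
        - ε * (Ω.card : ℝ) ≤ ∑ i ∈ Ω, (siteEnergy lennardJones y i / 2 - e₀)) :
    e₀ * N + c * (Nat.card {i : Fin N // ¬ Pf i} : ℝ)
      - ((|e₀| + c + 30375 / 2) * (6 * R + 1) ^ 3 + C * (12 * R + 1) ^ 3) *
          (Nat.card {i : Fin N // ¬ Pc i} : ℝ)
      - ε * N ≤ interactionEnergy lennardJones y := by
  classical
  -- the coarsely bad indices `Bad` and the guarded region `Ω`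
  obtain ⟨Bad, hBad⟩ : ∃ Bad : Finset (Fin N), Bad = Finset.univ.filter fun i => ¬ Pc i := ⟨_, rfl⟩
  obtain ⟨Ω, hΩdef⟩ : ∃ Ω : Finset (Fin N),
      Ω = Finset.univ.filter fun i => Pc i ∧ ∀ j, ¬ Pc j → R < dist (y i) (y j) := ⟨_, rfl⟩
  have hmemBad : ∀ i, i ∈ Bad ↔ ¬ Pc i := fun i => by rw [hBad]; simp
  have hmemΩ : ∀ i, i ∈ Ω ↔ Pc i ∧ ∀ j, ¬ Pc j → R < dist (y i) (y j) := fun i => by rw [hΩdef]; simp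
  -- (a) the local inequality on `Ω`
  have hI := hΩ Ω fun i hi => ((hmemΩ i).1 hi).1
  -- (b) the complement of `Ω` lies within `R` of `Bad`
  have hcompl : Ωᶜ ⊆ Finset.univ.filter fun i : Fin N => ∃ k ∈ Bad, dist (y i) (y k) ≤ R := by
    intro i hi
    rw [Finset.mem_compl, hmemΩ, not_and_or] at hi
    refine Finset.mem_filter.2 ⟨Finset.mem_univ _, ?_⟩
    rcases hi with hi | hi
    · exact ⟨i, (hmemBad i).2 hi, by rw [dist_self]; exact hR⟩
    · push Not at hi
      obtain ⟨j, hj, hij⟩ := hi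
      exact ⟨j, (hmemBad j).2 hj, hij⟩
  have hωc : ((Ωᶜ).card : ℝ) ≤ (Bad.card : ℝ) * (6 * R + 1) ^ 3 :=
    le_trans (by exact_mod_cast Finset.card_le_card hcompl) (card_near_le y hy hsep Bad hR)
  -- (c) the `R`-boundary of `Ω` lies within `2R` of `Bad`
  have hbdry : (Finset.univ.filter fun i : Fin N => i ∈ Ω ∧ ∃ j : Fin N, j ∉ Ω ∧ dist (y i) (y j) ≤ R) ⊆
      Finset.univ.filter fun i : Fin N => ∃ k ∈ Bad, dist (y i) (y k) ≤ 2 * R := by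
    intro i hi
    obtain ⟨-, j, hj, hij⟩ := (Finset.mem_filter.1 hi).2
    rw [hmemΩ, not_and_or] at hj
    refine Finset.mem_filter.2 ⟨Finset.mem_univ _, ?_⟩
    rcases hj with hj | hj
    · exact ⟨j, (hmemBad j).2 hj, by linarith⟩
    · push Not at hj
      obtain ⟨k, hk, hjk⟩ := hj
      exact ⟨k, (hmemBad k).2 hk, (dist_triangle (y i) (y j) (y k)).trans (by linarith)⟩
  have hbd : (Nat.card {i : Fin N // i ∈ Ω ∧ ∃ j : Fin N, j ∉ Ω ∧ dist (y i) (y j) ≤ R} : ℝ) ≤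
      (Bad.card : ℝ) * (12 * R + 1) ^ 3 := by
    rw [Nat.card_eq_fintype_card, Fintype.card_subtype, show 12 * R + 1 = 6 * (2 * R) + 1 by ring]
    exact le_trans (by exact_mod_cast Finset.card_le_card hbdry)
      (card_near_le y hy hsep Bad (by linarith : (0 : ℝ) ≤ 2 * R))
  -- (d) finely bad indices: all but those outside `Ω` are finely bad inside `Ω`
  have hfine : (Nat.card {i : Fin N // ¬ Pf i} : ℝ) ≤
      (Nat.card {i : Fin N // i ∈ Ω ∧ ¬ Pf i} : ℝ) + ((Ωᶜ).card : ℝ) := by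
    rw [Nat.card_eq_fintype_card, Fintype.card_subtype, Nat.card_eq_fintype_card, Fintype.card_subtype]
    have hsub : (Finset.univ.filter fun i : Fin N => ¬ Pf i) ⊆
        (Finset.univ.filter fun i : Fin N => i ∈ Ω ∧ ¬ Pf i) ∪ Ωᶜ := by
      intro i hi
      have hi' := (Finset.mem_filter.1 hi).2
      rw [Finset.mem_union, Finset.mem_filter, Finset.mem_compl]
      by_cases hiΩ : i ∈ Ω
      · exact Or.inl ⟨Finset.mem_univ _, hiΩ, hi'⟩
      · exact Or.inr hiΩ
    exact_mod_cast (Finset.card_le_card hsub).trans (Finset.card_union_le _ _)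
  -- (e) energies: `2·𝓔_N = Σ_Ω 𝓔ⁱ + Σ_{Ωᶜ} 𝓔ⁱ`, and `𝓔ⁱ ≥ −30375` off `Ω`
  have hE : 2 * interactionEnergy lennardJones y =
      ∑ i ∈ Ω, siteEnergy lennardJones y i + ∑ i ∈ Ωᶜ, siteEnergy lennardJones y i := by
    rw [two_mul_interactionEnergy, Finset.sum_add_sum_compl]
  have hoff : -(30375 : ℝ) * ((Ωᶜ).card : ℝ) ≤ ∑ i ∈ Ωᶜ, siteEnergy lennardJones y i := by
    have h := Finset.sum_le_sum fun i (_ : i ∈ Ωᶜ) => neg_le_siteEnergy y hsep i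
    rw [Finset.sum_const, nsmul_eq_mul] at h
    linarith
  have hsumΩ : ∑ i ∈ Ω, (siteEnergy lennardJones y i / 2 - e₀) =
      (∑ i ∈ Ω, siteEnergy lennardJones y i) / 2 - e₀ * Ω.card := by
    rw [Finset.sum_sub_distrib, Finset.sum_const, nsmul_eq_mul, Finset.sum_div, mul_comm]
  -- (f) cardinalities
  have hcard : (Ω.card : ℝ) + ((Ωᶜ).card : ℝ) = N := by
    exact_mod_cast (Finset.card_add_card_compl Ω).trans (Fintype.card_fin N)
  have hb : (Nat.card {i : Fin N // ¬ Pc i} : ℝ) = Bad.card := by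
    rw [Nat.card_eq_fintype_card, Fintype.card_subtype, hBad]
  rw [hb]
  -- bookkeeping
  have hωc0 : (0 : ℝ) ≤ (Ωᶜ).card := Nat.cast_nonneg _
  have h1 := mul_le_mul_of_nonneg_left hωc (by positivity : (0 : ℝ) ≤ |e₀| + c + 30375 / 2)
  have h2 := mul_le_mul_of_nonneg_left hfine hc
  have h3 := mul_le_mul_of_nonneg_left hbd hC
  have h4 := mul_le_mul_of_nonneg_right (le_abs_self e₀) hωc0
  have h5 : e₀ * Ω.card = e₀ * N - e₀ * (Ωᶜ).card := by rw [← hcard]; ring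
  have h6 : ε * Ω.card = ε * N - ε * (Ωᶜ).card := by rw [← hcard]; ring
  have h7 : (0 : ℝ) ≤ ε * (Ωᶜ).card := mul_nonneg hε hωc0
  rw [hsumΩ] at hI
  linarith [hI, hE, hoff, h1, h2, h3, h4, h5, h6, h7]

/-! ## The stub -/

/-- **Stub `stub_periodicAssembly` of line `elastic-coarse-to-fine` (crux `MinimiserShells`,
stmt-AtomisticToContinuum-9225).**  FROM THE LOCAL ELASTIC INEQUALITY TO THE PERIODIC COARSE-TO-FINE GAP: if
some `c > 0` admits, for every slack `ε > 0`, a radius `R > 0` and a charge `C ≥ 0` such that on every set `Ω`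
of coarsely well-shelled sites of a finite injective `1/3`-separated configuration
`c·#{finely bad in Ω} − C·#{R-boundary of Ω} − ε·#Ω ≤ Σ_{i∈Ω} (𝓔ⁱ/2 − e*)`, then for every `t > 0` there are
`s > 0` and `κ > 0` such that every periodic `Q` with `1/3`-separated points, at least `t·#motif` finely badly
shelled and fewer than `s·#motif` coarsely badly shelled motif sites has `e(Q) ≥ e* + κ` (`ε = c·t/8`,
`s = (c·t/8)/(c + 1 + 2M)`, `κ = c·t/2`; blocks `exists_blocks₂` at `GoodShell` / `LooseGoodShell (1/20)`,
assembly `le_interactionEnergy_of_local`, divide by `N`). -/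
theorem stub_periodicAssembly :
    (∃ c : ℝ, 0 < c ∧ ∀ ε : ℝ, 0 < ε → ∃ R : ℝ, 0 < R ∧ ∃ C : ℝ, 0 ≤ C ∧
      ∀ (N : ℕ) (y : Fin N → E3), Function.Injective y →
        (∀ i j : Fin N, i ≠ j → (1 : ℝ) / 3 ≤ dist (y i) (y j)) →
        ∀ Ω : Finset (Fin N),
          (∀ i ∈ Ω, LooseGoodShell (1 / 20)
            ((Measure.count : Measure E3).restrict ((fun z => z - y i) '' Set.range y))) →
          c * (Nat.card {i : Fin N // i ∈ Ω ∧
                ¬ GoodShell ((Measure.count : Measure E3).restrict ((fun z => z - y i) '' Set.range y))} : ℝ)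
            - C * (Nat.card {i : Fin N // i ∈ Ω ∧ ∃ j : Fin N, j ∉ Ω ∧ dist (y i) (y j) ≤ R} : ℝ)
            - ε * (Ω.card : ℝ)
          ≤ ∑ i ∈ Ω, (siteEnergy lennardJones y i / 2 - eStar)) →
    (∀ t : ℝ, 0 < t → ∃ s : ℝ, 0 < s ∧ ∃ κ : ℝ, 0 < κ ∧ ∀ Q : PeriodicConfiguration 3, IsSepThird Q →
      t * (Q.motif.card : ℝ) ≤ (looseBadMotifCount 0 Q : ℝ) →
      (looseBadMotifCount (1 / 20) Q : ℝ) < s * (Q.motif.card : ℝ) →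
      eStar + κ ≤ Q.energyPerParticle lennardJones) := by
  rintro ⟨c, hc, hH⟩ t ht
  obtain ⟨R, hR, C, hC, hloc⟩ := hH (c * t / 8) (by positivity)
  -- the constant `M` of the assembly, the coarse threshold `s` and the gap `κ = c·t/2`
  obtain ⟨M, hM⟩ : ∃ M : ℝ, M = (|eStar| + c + 30375 / 2) * (6 * R + 1) ^ 3 + C * (12 * R + 1) ^ 3 :=
    ⟨_, rfl⟩
  have hM0 : 0 ≤ M := by rw [hM]; positivity
  have hden : 0 < c + 1 + 2 * M := by positivity
  obtain ⟨s, hs_def⟩ : ∃ s : ℝ, s = c * t / 8 / (c + 1 + 2 * M) := ⟨_, rfl⟩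
  have hs : 0 < s := by rw [hs_def]; positivity
  have hsM : (c + 1 + 2 * M) * s = c * t / 8 := by rw [hs_def]; field_simp
  refine ⟨s, hs, c * t / 2, by positivity, fun Q hQ hfine hcoarse => ?_⟩
  -- pass to a large block of `Q`
  rw [looseBadMotifCount_zero] at hfine
  unfold looseBadMotifCount rerooted at hcoarse
  obtain ⟨N, hN, y, hy, hsep, hE, hbad₁, hbad₂⟩ :=
    exists_blocks₂ (G₁ := GoodShell) (G₂ := LooseGoodShell (1 / 20))
      (fun h => goodShell_congr_of_local h)
      (fun h => looseGood_congr_of_local (by norm_num : (0 : ℝ) ≤ 1 / 20) h)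
      Q hQ t s hfine hcoarse.le hs
  -- assemble the local inequality on the block
  have hA := le_interactionEnergy_of_local y hy hsep
    (fun i => LooseGoodShell (1 / 20) ((Measure.count : Measure E3).restrict ((fun z => z - y i) '' Set.range y)))
    (fun i => GoodShell ((Measure.count : Measure E3).restrict ((fun z => z - y i) '' Set.range y)))
    (e₀ := eStar) hc.le hC hR.le (by positivity) (fun Ω hΩ => hloc N y hy hsep Ω hΩ)
  rw [← hM] at hA
  -- divide by `N`
  have hNr : (0 : ℝ) < N := by exact_mod_cast hN
  have h1 := mul_le_mul_of_nonneg_left hbad₂ hM0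
  have h2 := mul_le_mul_of_nonneg_left hbad₁ hc.le
  have h3 : (c + 1 + 2 * M) * s * N = c * t / 8 * N := by rw [hsM]
  have h4 : 0 ≤ c * t * N := by positivity
  have key : (N : ℝ) * (eStar + c * t / 2) ≤ N * Q.energyPerParticle lennardJones := by
    linarith [hA, hE, h1, h2, h3, h4]
  exact le_of_mul_le_mul_left key hNr

end Summit.AtomisticToContinuum.Crystallization.Theorems.PalmUnimodularRigidityMinimiserShells.PeriodicAssembly

end
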